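import Literature.RepresentationTheory.MoeglinVignerasWaldspurger1987.RankOneTorusTrace
import Literature.RepresentationTheory.MoeglinVignerasWaldspurger1987.RankOneTorusBigCell
import HarnessLib

/-!
# TR: finite-level character non-vanishing for the rank `1 × 1` oscillator representation — the theorem

Topic `RepresentationTheory/MoeglinVignerasWaldspurger1987`; namespace
`Literature.RepresentationTheory.MoeglinVignerasWaldspurger1987`.  ONE THEOREM (proof lane): the statement «TR» of
the character route to the `c3` wall `NonPeriodic₁₁` (cell `hodgecm-mathlib`), assembled from the torus big-cell
package of the place (`rankOne_torus_bigCell_package`, `RankOneTorusBigCell.lean`) and the generic finite-level trace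
(`rankOne_torusTrace_ne_zero_of_bigCellPackage`, `RankOneTorusTrace.lean`, over
`HeisenbergGroup.trace_restrict_fixed_eq_of_bigCell_family`), for the Borel σ-algebra and Mathlib's Haar measure
`Measure.addHaar` on `F_v` and the conductor exponent of `ψ_v`.

## References
* [Weil1964] A. Weil, Acta Math. 111 (1964), n° 13 (29); Chap. II n° 27.
* [MoeglinVignerasWaldspurger1987] C. Mœglin, M.-F. Vignéras, J.-L. Waldspurger, LNM 1291 (1987), Chap. 2 II.8, Chap. 3 §IV.
-/

set_option autoImplicit false

noncomputable section

open NumberField IsDedekindDomain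
open _root_.MeasureTheory
open scoped Matrix
open Literature.RepresentationTheory.HeisenbergGroup (MpPsi)
open Literature.NumberTheory.GelbartRogawski1991.UnitaryDualPair.LocalSplitting (iota LocalMp localSchrodinger)
open Literature.NumberTheory.Automorphic

namespace Literature.RepresentationTheory.MoeglinVignerasWaldspurger1987

/-- **TR — finite-level character non-vanishing of the `(U(1), U(1))` oscillator representation.**  For a `1 × 1`
Gram matrix `t`, a non-split place `v`, a section `s₁ : U(J_t)(F_v) →* S̃p(𝕎_v)` over `ι_v` with `ω_{s₁}` smooth
and `z₀ ∈ U(J_t)(F_v) = E_v¹` with `z₀² ≠ 1` (so `ι_v(z₀)` lies in Weil's big cell): there is an open subgroup `K₀`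
such that for every open subgroup `K ≤ K₀` and every finite-dimensional `W` = the `ω_{s₁}(K)`-fixed vectors,
`tr(ω_{s₁}(z₀) | W) ≠ 0` (the value is `c · g(q_{z₀})`, a section scalar times a stable Gauss integral — Howe's
character `|N_{E/F}(1 - z₀)|_v^{-1/2} · γ` read at finite level, proved from the Schrödinger kernel at every non-split
`v`, dyadic and ramified included). [cite: Weil1964, n° 13 (29) p. 160, Chap. II n° 27 p. 175; MoeglinVignerasWaldspurger1987, Chap. 2 II.8] -/
theorem rankOne_torusTrace_ne_zero
    (F : Type) [Field F] [NumberField F] (E : Type) [Field E] [NumberField E] [Algebra F E]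
    [Algebra.IsQuadraticExtension F E] (c : E ≃ₐ[F] E) (δ : E) (hcδ : c δ = -δ) (hδ : δ ≠ 0) (d : F)
    (hd : δ * δ = algebraMap F E d) (t : Matrix (Fin 1) (Fin 1) F) (ht : t.IsSymm) (htd : IsUnit t.det)
    (J₁ : Matrix (Fin 1) (Fin 1) E) (hJ₁ : J₁ = t.map (algebraMap F E)) (v : HeightOneSpectrum (𝓞 F))
    (hE : IsField (UnitaryGroup.LocalRing E v))
    (s₁ : UnitaryGroup.localPi E c 1 J₁ v →* LocalMp F 1 t v)
    (hs₁ : ∀ g, MpPsi.proj _ (s₁ g) = iota F E c 1 hcδ hδ hd t ht hJ₁ v g)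
    (hsm₁ : Representation.IsSmooth ((MpPsi.toRep (localSchrodinger F 1 t v)).comp s₁))
    (z₀ : UnitaryGroup.localPi E c 1 J₁ v) (hz₀ : z₀ * z₀ ≠ 1) :
    ∃ K₀ : Subgroup (UnitaryGroup.localPi E c 1 J₁ v), IsOpen (K₀ : Set (UnitaryGroup.localPi E c 1 J₁ v)) ∧
      ∀ K : Subgroup (UnitaryGroup.localPi E c 1 J₁ v), IsOpen (K : Set (UnitaryGroup.localPi E c 1 J₁ v)) → K ≤ K₀ →
        ∀ (W : Submodule ℂ (SchwartzBruhat (Fin 1 → v.adicCompletion F))) [FiniteDimensional ℂ W],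
          (∀ f, f ∈ W ↔ ∀ k ∈ K, ((MpPsi.toRep (localSchrodinger F 1 t v)).comp s₁) k f = f) →
          ∀ hW : ∀ w ∈ W, ((MpPsi.toRep (localSchrodinger F 1 t v)).comp s₁) z₀ w ∈ W,
            LinearMap.trace ℂ W ((((MpPsi.toRep (localSchrodinger F 1 t v)).comp s₁) z₀).restrict hW) ≠ 0 := by
  letI : MeasurableSpace (v.adicCompletion F) := borel _
  haveI : BorelSpace (v.adicCompletion F) := ⟨rfl⟩
  obtain ⟨m, hm⟩ := (isContinuousNontrivial_adeleAddCharAt F v).exists_hasConductorExp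
  exact rankOne_torusTrace_ne_zero_of_bigCellPackage F E c δ hcδ hδ t htd J₁ hJ₁ v hE s₁ hsm₁ z₀ Measure.addHaar m hm
    (rankOne_torus_bigCell_package F E c δ hcδ hδ d hd t ht htd J₁ hJ₁ v hE s₁ hs₁ hsm₁ z₀ hz₀ Measure.addHaar m hm)

end Literature.RepresentationTheory.MoeglinVignerasWaldspurger1987

end
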